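import Mathlib.Analysis.InnerProductSpace.Calculus
import Mathlib.Analysis.Calculus.Deriv.MeanValue
import Mathlib.Analysis.SpecialFunctions.Log.Deriv
import Mathlib.Analysis.SpecialFunctions.ExpDeriv
import Mathlib.Algebra.Order.Floor.Defs
import HarnessLib

/-!
# Euler-zone growth bound for `y″ = q y` with an inverse-square coefficient

Topic `Literature/Analysis/ODE` (namespace `Literature.Analysis.ODE`). The a priori bound for
COMPLEX solutions of the scalar linear equation `y″ = q(x) y` (`q` complex) on an interval
`[x₁, x₂] ⊂ (0, ∞)` on which the coefficient is only known to be of EULER (inverse-square) size,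
`x² ‖q x‖ ≤ n²`:

* `abs_eulerEnergyDeriv_le` — the scale-invariant energy `F = n²|y|² + x²|y′|²` obeys
  `|F′| ≤ ((2n + 2)/x) F` (Cauchy–Schwarz), i.e. `|dF/d log x| ≤ (2n+2) F`;
* `eulerEnergy_mul_pow_le_of_le` / `eulerEnergy_mul_pow_le_of_ge` — hence FORWARD
  `F(x) ≤ (x/x₀)^{2n+2} F(x₀)` (`x₀ ≤ x`; `F·x^{-(2n+2)}` is non-increasing) and BACKWARD
  `F(x) ≤ (x₀/x)^{2n+2} F(x₀)` (`x ≤ x₀`; `F·x^{2n+2}` is non-decreasing);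
* `eulerEnergy_le_mul_pow` — two-sided: `F(x) ≤ (x₂/x₁)^{2n+2} F(x₀)` for all `x₀, x ∈ [x₁, x₂]`;
* `norm_add_mul_norm_deriv_le_of_euler` — in amplitude form (`1 ≤ n`):
  `‖y x‖ + x‖y′ x‖ ≤ 2n (x₂/x₁)^{n+1} (‖y x₀‖ + x₀‖y′ x₀‖)`;
* `norm_add_mul_norm_deriv_le_of_sq_mul_norm_le` — the same with a real constant `K ≥ 0`,
  `x²‖q‖ ≤ K²`, and `n = ⌈K⌉₊ + 1`.

The point is the POLYNOMIAL dependence on the ratio `x₂/x₁`: the crude transition-zone bound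
(`Literature/Analysis/ODE/TransitionZoneGrowth.lean`, `‖q‖ ≤ K²` on a zone of length `L`, growth
`e^{KL}`) applied on `[x₁, x₂]` with `K² = n²/x₁²` would give `e^{n(x₂ − x₁)/x₁}`, exponential in
`x₂/x₁`; the Euler weight `x²` on `|y′|²` (equivalently the substitution `t = log x`, under which
`x² q` becomes a bounded coefficient on a zone of length `log(x₂/x₁)`) gives `(x₂/x₁)^{2n+2}`. This is
the elementary bound used across the "Euler zone" of an ODE with a regular-singular-type
coefficient `q ∼ −(ξ² + ¼)/x²` between an oscillatory pocket at small `x` and the matching radius,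
when only polynomial constants in the large parameter `x₂/x₁` matter (e.g. the blown-up radial
chart `x = (r − r₊)/(r₊ − r₋)` of the near-extremal Kerr throat, where `x₂/x₁ ≍ κ⁻¹`).

Hypotheses are pointwise `HasDerivAt` statements on the closed interval for `y, y′ : ℝ → ℂ`; `ℂ`
is used as a real inner-product space only through `HasDerivAt.norm_sq` and
`abs_real_inner_le_norm`. Everything is proved; the exponent `2n + 2` is not optimal (the sharp
rate is `2·max(n, ½)`-type) and no attempt at optimality is made.

## References
* P. Hartman, *Ordinary Differential Equations*, Classics in Applied Mathematics 38 (SIAM 2002),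
  Ch. IV §1, Lemma 1.1 (a priori bounds for linear systems; here in the variable `log x`) and
  Ch. X §17 (Euler-type / regular-singular comparison). Key `Hartman2002`.
* F. W. J. Olver, *Asymptotics and Special Functions* (Academic Press 1974), Ch. 6 §§1–2
  (Liouville–Green with the `x^{-2}` renormalisation at a double pole). Key `Olver1974`.
-/

noncomputable section

open Set Filter Topology
open scoped RealInnerProductSpace

namespace Literature.Analysis.ODE

/-! ### The Euler energy `c |y|² + x² |y′|²` along `y″ = q y` -/

/-- Derivative of the Euler-weighted energy along `y″ = q y` (complex `y`, `q`; `ℂ` as a real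
inner-product space): `(c |y|² + x²|y′|²)′ = c · 2⟪y, y′⟫ + 2x |y′|² + x² · 2⟪y′, q y⟫`. [folklore] -/
theorem hasDerivAt_eulerEnergy {y y' : ℝ → ℂ} {q : ℝ → ℂ} (c : ℝ) {x : ℝ}
    (hy : HasDerivAt y (y' x) x) (hy' : HasDerivAt y' (q x * y x) x) :
    HasDerivAt (fun t => c * ‖y t‖ ^ 2 + t ^ 2 * ‖y' t‖ ^ 2)
      (c * (2 * ⟪y x, y' x⟫) + (2 * x * ‖y' x‖ ^ 2 + x ^ 2 * (2 * ⟪y' x, q x * y x⟫))) x := by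
  have h1 : HasDerivAt (fun t => ‖y t‖ ^ 2) (2 * ⟪y x, y' x⟫) x := hy.norm_sq
  have h2 : HasDerivAt (fun t => ‖y' t‖ ^ 2) (2 * ⟪y' x, q x * y x⟫) x := hy'.norm_sq
  have h3 : HasDerivAt (fun t : ℝ => t ^ 2) (2 * x) x := by simpa using hasDerivAt_pow 2 x
  exact ((h1.const_mul c).add (h3.mul h2)).congr_deriv (by ring)

/-- **The Euler energy inequality.** If `0 ≤ n`, `0 < x` and `x²‖w‖ ≤ n²` then
`|n² · 2⟪u, v⟫ + 2x|v|² + x² · 2⟪v, w u⟫| ≤ ((2n + 2)/x) · (n²|u|² + x²|v|²)` (Cauchy–Schwarz and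
`2n|u|·x|v| ≤ n²|u|² + x²|v|²`): along `y″ = q y` with `x²‖q‖ ≤ n²` the energy
`F = n²|y|² + x²|y′|²` obeys `|F′| ≤ ((2n+2)/x) F`. [folklore] -/
theorem abs_eulerEnergyDeriv_le {n x : ℝ} (hn : 0 ≤ n) (hx : 0 < x) {u v w : ℂ}
    (hw : x ^ 2 * ‖w‖ ≤ n ^ 2) :
    |n ^ 2 * (2 * ⟪u, v⟫) + (2 * x * ‖v‖ ^ 2 + x ^ 2 * (2 * ⟪v, w * u⟫))| ≤
      (2 * n + 2) / x * (n ^ 2 * ‖u‖ ^ 2 + x ^ 2 * ‖v‖ ^ 2) := by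
  have h1 : |⟪u, v⟫| ≤ ‖u‖ * ‖v‖ := abs_real_inner_le_norm u v
  have h2 : x ^ 2 * |⟪v, w * u⟫| ≤ n ^ 2 * (‖u‖ * ‖v‖) :=
    calc x ^ 2 * |⟪v, w * u⟫| ≤ x ^ 2 * (‖v‖ * ‖w * u‖) := by
          gcongr; exact abs_real_inner_le_norm v (w * u)
      _ = x ^ 2 * ‖w‖ * (‖u‖ * ‖v‖) := by rw [norm_mul]; ring
      _ ≤ n ^ 2 * (‖u‖ * ‖v‖) := by gcongr
  obtain ⟨h1a, h1b⟩ := abs_le.1 h1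
  have h2a : -(n ^ 2 * (‖u‖ * ‖v‖)) ≤ x ^ 2 * ⟪v, w * u⟫ := by
    have : -(x ^ 2 * |⟪v, w * u⟫|) ≤ x ^ 2 * ⟪v, w * u⟫ := by
      rw [← mul_neg]; exact mul_le_mul_of_nonneg_left (neg_abs_le _) (sq_nonneg x)
    linarith
  have h2b : x ^ 2 * ⟪v, w * u⟫ ≤ n ^ 2 * (‖u‖ * ‖v‖) :=
    (mul_le_mul_of_nonneg_left (le_abs_self _) (sq_nonneg x)).trans h2
  -- `2 n² |u||v| ≤ (n/x) F`
  have h3 : 2 * n ^ 2 * (‖u‖ * ‖v‖) ≤ n / x * (n ^ 2 * ‖u‖ ^ 2 + x ^ 2 * ‖v‖ ^ 2) := by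
    rw [div_mul_eq_mul_div, le_div_iff₀ hx]
    nlinarith [mul_nonneg hn (sq_nonneg (n * ‖u‖ - x * ‖v‖))]
  have h4 : 2 * x * ‖v‖ ^ 2 = 2 / x * (x ^ 2 * ‖v‖ ^ 2) := by
    field_simp
  have h5 : 0 ≤ 2 / x * (n ^ 2 * ‖u‖ ^ 2) := by positivity
  have hsum : 2 * n ^ 2 * (‖u‖ * ‖v‖) + 2 * n ^ 2 * (‖u‖ * ‖v‖) + 2 * x * ‖v‖ ^ 2 ≤
      (2 * n + 2) / x * (n ^ 2 * ‖u‖ ^ 2 + x ^ 2 * ‖v‖ ^ 2) := by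
    have e : (2 * n + 2) / x * (n ^ 2 * ‖u‖ ^ 2 + x ^ 2 * ‖v‖ ^ 2) =
        n / x * (n ^ 2 * ‖u‖ ^ 2 + x ^ 2 * ‖v‖ ^ 2) + n / x * (n ^ 2 * ‖u‖ ^ 2 + x ^ 2 * ‖v‖ ^ 2) +
          (2 / x * (x ^ 2 * ‖v‖ ^ 2) + 2 / x * (n ^ 2 * ‖u‖ ^ 2)) := by ring
    rw [e]; linarith
  have hn2 : 0 ≤ n ^ 2 := sq_nonneg n
  refine abs_le.2 ⟨?_, ?_⟩
  · nlinarith [mul_le_mul_of_nonneg_left h1a hn2, sq_nonneg ‖v‖, hx.le]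
  · nlinarith [mul_le_mul_of_nonneg_left h1b hn2]

/-! ### One-sided growth: forward and backward from the base point -/

section Growth

variable {y y' : ℝ → ℂ} {q : ℝ → ℂ} {a b n : ℝ}

/-- **Forward Euler growth.** If `y″ = q y` on `[a, b] ⊂ (0, ∞)` with `x²‖q x‖ ≤ n²` (`n ≥ 0`) there,
then for `a ≤ x₀ ≤ x ≤ b` the Euler energy `F = n²|y|² + x²|y′|²` satisfies
`F(x) · x^{-(2n+2)} ≤ F(x₀) · x₀^{-(2n+2)}` — the function `F · x^{-(2n+2)}` is non-increasing
(`(F x^{-p})′ = x^{-p}(F′ − pF/x) ≤ 0` for `p = 2n + 2`); the real power is written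
`exp(−(2n+2) log x)`. [folklore] -/
theorem eulerEnergy_mul_pow_le_of_le (ha : 0 < a) (hn : 0 ≤ n)
    (hy : ∀ x ∈ Icc a b, HasDerivAt y (y' x) x ∧ HasDerivAt y' (q x * y x) x)
    (hq : ∀ x ∈ Icc a b, x ^ 2 * ‖q x‖ ≤ n ^ 2) {x₀ x : ℝ} (hx₀ : x₀ ∈ Icc a b)
    (hx : x ∈ Icc a b) (hle : x₀ ≤ x) :
    (n ^ 2 * ‖y x‖ ^ 2 + x ^ 2 * ‖y' x‖ ^ 2) * Real.exp (-(2 * n + 2) * Real.log x) ≤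
      (n ^ 2 * ‖y x₀‖ ^ 2 + x₀ ^ 2 * ‖y' x₀‖ ^ 2) * Real.exp (-(2 * n + 2) * Real.log x₀) := by
  -- `G(t) = F(t) · exp(-(2n+2) log t)` is antitone on `[a, b]`
  set F : ℝ → ℝ := fun t => n ^ 2 * ‖y t‖ ^ 2 + t ^ 2 * ‖y' t‖ ^ 2 with hF
  set F' : ℝ → ℝ := fun t =>
    n ^ 2 * (2 * ⟪y t, y' t⟫) + (2 * t * ‖y' t‖ ^ 2 + t ^ 2 * (2 * ⟪y' t, q t * y t⟫)) with hF'
  set E : ℝ → ℝ := fun t => Real.exp (-(2 * n + 2) * Real.log t) with hE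
  have hpos : ∀ t ∈ Icc a b, 0 < t := fun t ht => ha.trans_le ht.1
  have hFd : ∀ t ∈ Icc a b, HasDerivAt F (F' t) t := fun t ht =>
    hasDerivAt_eulerEnergy (n ^ 2) (hy t ht).1 (hy t ht).2
  have hEd : ∀ t ∈ Icc a b, HasDerivAt E (E t * (-(2 * n + 2) / t)) t := by
    intro t ht
    have h1 : HasDerivAt (fun s => -(2 * n + 2) * Real.log s) (-(2 * n + 2) * t⁻¹) t :=
      (Real.hasDerivAt_log (hpos t ht).ne').const_mul _
    exact h1.exp.congr_deriv (by simp only [hE]; ring)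
  have hGd : ∀ t ∈ Icc a b, HasDerivAt (fun s => F s * E s)
      (F' t * E t + F t * (E t * (-(2 * n + 2) / t))) t := fun t ht =>
    (hFd t ht).mul (hEd t ht)
  have hanti : AntitoneOn (fun s => F s * E s) (Icc a b) := by
    refine antitoneOn_of_hasDerivWithinAt_nonpos (convex_Icc a b)
      (fun t ht => (hGd t ht).continuousAt.continuousWithinAt)
      (fun t ht => (hGd t (interior_subset ht)).hasDerivWithinAt) fun t ht => ?_
    have ht' : t ∈ Icc a b := interior_subset ht
    have htp : 0 < t := hpos t ht'
    have hb := abs_eulerEnergyDeriv_le (u := y t) (v := y' t) (w := q t) hn htp (hq t ht')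
    have hle' : F' t ≤ (2 * n + 2) / t * F t := (abs_le.1 hb).2
    have hEt : 0 < E t := Real.exp_pos _
    have : F' t * E t + F t * (E t * (-(2 * n + 2) / t)) = E t * (F' t - (2 * n + 2) / t * F t) := by
      ring
    rw [this]
    exact mul_nonpos_of_nonneg_of_nonpos hEt.le (by linarith)
  exact hanti hx₀ hx hle

/-- **Backward Euler growth.** If `y″ = q y` on `[a, b] ⊂ (0, ∞)` with `x²‖q x‖ ≤ n²` (`n ≥ 0`) there,
then for `a ≤ x ≤ x₀ ≤ b`: `F(x) · x^{2n+2} ≤ F(x₀) · x₀^{2n+2}` for the Euler energy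
`F = n²|y|² + x²|y′|²` — the function `F · x^{2n+2}` is non-decreasing (the real power is written
`exp((2n+2) log x)`). [folklore] -/
theorem eulerEnergy_mul_pow_le_of_ge (ha : 0 < a) (hn : 0 ≤ n)
    (hy : ∀ x ∈ Icc a b, HasDerivAt y (y' x) x ∧ HasDerivAt y' (q x * y x) x)
    (hq : ∀ x ∈ Icc a b, x ^ 2 * ‖q x‖ ≤ n ^ 2) {x₀ x : ℝ} (hx₀ : x₀ ∈ Icc a b)
    (hx : x ∈ Icc a b) (hle : x ≤ x₀) :
    (n ^ 2 * ‖y x‖ ^ 2 + x ^ 2 * ‖y' x‖ ^ 2) * Real.exp ((2 * n + 2) * Real.log x) ≤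
      (n ^ 2 * ‖y x₀‖ ^ 2 + x₀ ^ 2 * ‖y' x₀‖ ^ 2) * Real.exp ((2 * n + 2) * Real.log x₀) := by
  set F : ℝ → ℝ := fun t => n ^ 2 * ‖y t‖ ^ 2 + t ^ 2 * ‖y' t‖ ^ 2 with hF
  set F' : ℝ → ℝ := fun t =>
    n ^ 2 * (2 * ⟪y t, y' t⟫) + (2 * t * ‖y' t‖ ^ 2 + t ^ 2 * (2 * ⟪y' t, q t * y t⟫)) with hF'
  set E : ℝ → ℝ := fun t => Real.exp ((2 * n + 2) * Real.log t) with hE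
  have hpos : ∀ t ∈ Icc a b, 0 < t := fun t ht => ha.trans_le ht.1
  have hFd : ∀ t ∈ Icc a b, HasDerivAt F (F' t) t := fun t ht =>
    hasDerivAt_eulerEnergy (n ^ 2) (hy t ht).1 (hy t ht).2
  have hEd : ∀ t ∈ Icc a b, HasDerivAt E (E t * ((2 * n + 2) / t)) t := by
    intro t ht
    have h1 : HasDerivAt (fun s => (2 * n + 2) * Real.log s) ((2 * n + 2) * t⁻¹) t :=
      (Real.hasDerivAt_log (hpos t ht).ne').const_mul _
    exact h1.exp.congr_deriv (by simp only [hE]; ring)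
  have hGd : ∀ t ∈ Icc a b, HasDerivAt (fun s => F s * E s)
      (F' t * E t + F t * (E t * ((2 * n + 2) / t))) t := fun t ht =>
    (hFd t ht).mul (hEd t ht)
  have hmono : MonotoneOn (fun s => F s * E s) (Icc a b) := by
    refine monotoneOn_of_hasDerivWithinAt_nonneg (convex_Icc a b)
      (fun t ht => (hGd t ht).continuousAt.continuousWithinAt)
      (fun t ht => (hGd t (interior_subset ht)).hasDerivWithinAt) fun t ht => ?_
    have ht' : t ∈ Icc a b := interior_subset ht
    have htp : 0 < t := hpos t ht'
    have hb := abs_eulerEnergyDeriv_le (u := y t) (v := y' t) (w := q t) hn htp (hq t ht')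
    have hle' : -((2 * n + 2) / t * F t) ≤ F' t := (abs_le.1 hb).1
    have hEt : 0 < E t := Real.exp_pos _
    have : F' t * E t + F t * (E t * ((2 * n + 2) / t)) = E t * (F' t + (2 * n + 2) / t * F t) := by
      ring
    rw [this]
    exact mul_nonneg hEt.le (by linarith)
  exact hmono hx hx₀ hle

end Growth

/-! ### Two-sided polynomial growth on `[x₁, x₂]` -/

/-- **Euler-zone energy growth (two-sided).** Let `y″ = q y` on `[x₁, x₂]` with `0 < x₁` and
`x²‖q x‖ ≤ n²` there (`n : ℕ`). Then for all `x₀, x ∈ [x₁, x₂]` the Euler energy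
`F = n²|y|² + x²|y′|²` satisfies `F(x) ≤ (x₂/x₁)^{2n+2} F(x₀)`. [folklore] -/
theorem eulerEnergy_le_mul_pow {y y' : ℝ → ℂ} {q : ℝ → ℂ} {x₁ x₂ : ℝ} {n : ℕ} (hx₁ : 0 < x₁)
    (hy : ∀ x ∈ Icc x₁ x₂, HasDerivAt y (y' x) x ∧ HasDerivAt y' (q x * y x) x)
    (hq : ∀ x ∈ Icc x₁ x₂, x ^ 2 * ‖q x‖ ≤ (n : ℝ) ^ 2) {x₀ x : ℝ} (hx₀ : x₀ ∈ Icc x₁ x₂)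
    (hx : x ∈ Icc x₁ x₂) :
    (n : ℝ) ^ 2 * ‖y x‖ ^ 2 + x ^ 2 * ‖y' x‖ ^ 2 ≤
      (x₂ / x₁) ^ (2 * n + 2) * ((n : ℝ) ^ 2 * ‖y x₀‖ ^ 2 + x₀ ^ 2 * ‖y' x₀‖ ^ 2) := by
  have hn : (0 : ℝ) ≤ n := n.cast_nonneg
  have hx0p : 0 < x₀ := hx₁.trans_le hx₀.1
  have hxp : 0 < x := hx₁.trans_le hx.1
  have hF0 : 0 ≤ (n : ℝ) ^ 2 * ‖y x₀‖ ^ 2 + x₀ ^ 2 * ‖y' x₀‖ ^ 2 := by positivity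
  -- real powers as exponentials of logarithms
  have hexp : ∀ {t : ℝ}, 0 < t → Real.exp ((2 * n + 2) * Real.log t) = t ^ (2 * n + 2) := by
    intro t ht
    rw [show (2 * (n : ℝ) + 2) = ((2 * n + 2 : ℕ) : ℝ) by push_cast; ring, ← Real.log_pow,
      Real.exp_log (pow_pos ht _)]
  have hexp' : ∀ {t : ℝ}, 0 < t → Real.exp (-(2 * n + 2) * Real.log t) = (t ^ (2 * n + 2))⁻¹ := by
    intro t ht
    rw [neg_mul, Real.exp_neg, hexp ht]
  -- the ratio `(x₂/x₁)^{2n+2}` dominates both one-sided ratios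
  have hratio : ∀ {s t : ℝ}, s ∈ Icc x₁ x₂ → t ∈ Icc x₁ x₂ →
      t ^ (2 * n + 2) / s ^ (2 * n + 2) ≤ (x₂ / x₁) ^ (2 * n + 2) := by
    intro s t hs ht
    have hsp : 0 < s := hx₁.trans_le hs.1
    have htp : 0 < t := hx₁.trans_le ht.1
    rw [div_pow, div_le_div_iff₀ (pow_pos hsp _) (pow_pos hx₁ _), ← mul_pow, ← mul_pow]
    exact pow_le_pow_left₀ (by positivity) (mul_le_mul ht.2 hs.1 hx₁.le (hsp.le.trans hs.2)) _
  rcases le_total x₀ x with hle | hle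
  · have h := eulerEnergy_mul_pow_le_of_le hx₁ hn hy hq hx₀ hx hle
    rw [hexp' hxp, hexp' hx0p, ← div_eq_mul_inv, ← div_eq_mul_inv,
      div_le_div_iff₀ (pow_pos hxp _) (pow_pos hx0p _)] at h
    calc (n : ℝ) ^ 2 * ‖y x‖ ^ 2 + x ^ 2 * ‖y' x‖ ^ 2
        ≤ x ^ (2 * n + 2) / x₀ ^ (2 * n + 2) *
            ((n : ℝ) ^ 2 * ‖y x₀‖ ^ 2 + x₀ ^ 2 * ‖y' x₀‖ ^ 2) := by
          rw [div_mul_eq_mul_div, le_div_iff₀ (pow_pos hx0p _)]; linarith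
      _ ≤ (x₂ / x₁) ^ (2 * n + 2) * ((n : ℝ) ^ 2 * ‖y x₀‖ ^ 2 + x₀ ^ 2 * ‖y' x₀‖ ^ 2) :=
          mul_le_mul_of_nonneg_right (hratio hx₀ hx) hF0
  · have h := eulerEnergy_mul_pow_le_of_ge hx₁ hn hy hq hx₀ hx hle
    rw [hexp hxp, hexp hx0p] at h
    calc (n : ℝ) ^ 2 * ‖y x‖ ^ 2 + x ^ 2 * ‖y' x‖ ^ 2
        ≤ x₀ ^ (2 * n + 2) / x ^ (2 * n + 2) *
            ((n : ℝ) ^ 2 * ‖y x₀‖ ^ 2 + x₀ ^ 2 * ‖y' x₀‖ ^ 2) := by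
          rw [div_mul_eq_mul_div, le_div_iff₀ (pow_pos hxp _)]; linarith
      _ ≤ (x₂ / x₁) ^ (2 * n + 2) * ((n : ℝ) ^ 2 * ‖y x₀‖ ^ 2 + x₀ ^ 2 * ‖y' x₀‖ ^ 2) :=
          mul_le_mul_of_nonneg_right (hratio hx hx₀) hF0

/-- **Euler-zone growth bound, amplitude form.** Let `y″ = q y` on `[x₁, x₂]` with `0 < x₁` and
`x²‖q x‖ ≤ n²` there, `1 ≤ n` (`n : ℕ`). Then for all `x₀, x ∈ [x₁, x₂]` (forward AND backward)
`‖y x‖ + x‖y′ x‖ ≤ 2n · (x₂/x₁)^{n+1} · (‖y x₀‖ + x₀‖y′ x₀‖)` — polynomial in the ratio `x₂/x₁`.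
[folklore] -/
theorem norm_add_mul_norm_deriv_le_of_euler {y y' : ℝ → ℂ} {q : ℝ → ℂ} {x₁ x₂ : ℝ} {n : ℕ}
    (hx₁ : 0 < x₁) (hn : 1 ≤ n)
    (hy : ∀ x ∈ Icc x₁ x₂, HasDerivAt y (y' x) x ∧ HasDerivAt y' (q x * y x) x)
    (hq : ∀ x ∈ Icc x₁ x₂, x ^ 2 * ‖q x‖ ≤ (n : ℝ) ^ 2) {x₀ x : ℝ} (hx₀ : x₀ ∈ Icc x₁ x₂)
    (hx : x ∈ Icc x₁ x₂) :
    ‖y x‖ + x * ‖y' x‖ ≤ 2 * n * (x₂ / x₁) ^ (n + 1) * (‖y x₀‖ + x₀ * ‖y' x₀‖) := by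
  have hE := eulerEnergy_le_mul_pow hx₁ hy hq hx₀ hx
  have hn1 : (1 : ℝ) ≤ n := by exact_mod_cast hn
  have hx0p : 0 < x₀ := hx₁.trans_le hx₀.1
  have hxp : 0 < x := hx₁.trans_le hx.1
  have hR : 0 ≤ (x₂ / x₁) ^ (n + 1) :=
    pow_nonneg (div_nonneg (hx₁.le.trans (hx.1.trans hx.2)) hx₁.le) _
  have hR2 : 0 ≤ (x₂ / x₁) ^ (2 * n + 2) := by
    rw [show 2 * n + 2 = (n + 1) * 2 by ring, pow_mul]; positivity
  set A := ‖y x₀‖ + x₀ * ‖y' x₀‖ with hA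
  have hA0 : 0 ≤ A := by positivity
  -- `F(x₀) ≤ n² A²`
  have hF0 : (n : ℝ) ^ 2 * ‖y x₀‖ ^ 2 + x₀ ^ 2 * ‖y' x₀‖ ^ 2 ≤ (n : ℝ) ^ 2 * A ^ 2 := by
    have h1 : x₀ ^ 2 * ‖y' x₀‖ ^ 2 ≤ (n : ℝ) ^ 2 * (x₀ * ‖y' x₀‖) ^ 2 := by
      rw [mul_pow]
      exact le_mul_of_one_le_left (by positivity) (one_le_pow₀ hn1)
    have h2 : ‖y x₀‖ ^ 2 + (x₀ * ‖y' x₀‖) ^ 2 ≤ A ^ 2 := by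
      rw [hA]; nlinarith [mul_nonneg (norm_nonneg (y x₀)) (mul_nonneg hx0p.le (norm_nonneg (y' x₀)))]
    nlinarith [mul_le_mul_of_nonneg_left h2 (sq_nonneg (n : ℝ))]
  -- `(‖y x‖ + x‖y′ x‖)² ≤ 2 F(x)`
  have hF1 : (‖y x‖ + x * ‖y' x‖) ^ 2 ≤ 2 * ((n : ℝ) ^ 2 * ‖y x‖ ^ 2 + x ^ 2 * ‖y' x‖ ^ 2) := by
    have h1 : ‖y x‖ ^ 2 ≤ (n : ℝ) ^ 2 * ‖y x‖ ^ 2 :=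
      le_mul_of_one_le_left (sq_nonneg _) (one_le_pow₀ hn1)
    nlinarith [sq_nonneg (‖y x‖ - x * ‖y' x‖)]
  have hB : (‖y x‖ + x * ‖y' x‖) ^ 2 ≤ (2 * n * (x₂ / x₁) ^ (n + 1) * A) ^ 2 :=
    calc (‖y x‖ + x * ‖y' x‖) ^ 2
        ≤ 2 * ((x₂ / x₁) ^ (2 * n + 2) * ((n : ℝ) ^ 2 * ‖y x₀‖ ^ 2 + x₀ ^ 2 * ‖y' x₀‖ ^ 2)) := by
          linarith
      _ ≤ 2 * ((x₂ / x₁) ^ (2 * n + 2) * ((n : ℝ) ^ 2 * A ^ 2)) :=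
          mul_le_mul_of_nonneg_left (mul_le_mul_of_nonneg_left hF0 hR2) two_pos.le
      _ ≤ 4 * ((x₂ / x₁) ^ (2 * n + 2) * ((n : ℝ) ^ 2 * A ^ 2)) := by
          have : 0 ≤ (x₂ / x₁) ^ (2 * n + 2) * ((n : ℝ) ^ 2 * A ^ 2) :=
            mul_nonneg hR2 (by positivity)
          nlinarith
      _ = (2 * n * (x₂ / x₁) ^ (n + 1) * A) ^ 2 := by ring
  exact (pow_le_pow_iff_left₀ (by positivity) (by positivity) two_ne_zero).1 hB

/-- **Euler-zone growth bound with a real constant.** Let `y″ = q y` on `[x₁, x₂]` with `0 < x₁`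
and `x²‖q x‖ ≤ K²` there (`K ≥ 0`). Then with `n = ⌈K⌉₊ + 1`, for all `x₀, x ∈ [x₁, x₂]`,
`‖y x‖ + x‖y′ x‖ ≤ 2n · (x₂/x₁)^{n+1} · (‖y x₀‖ + x₀‖y′ x₀‖)`. [folklore] -/
theorem norm_add_mul_norm_deriv_le_of_sq_mul_norm_le {y y' : ℝ → ℂ} {q : ℝ → ℂ} {x₁ x₂ K : ℝ}
    (hx₁ : 0 < x₁) (hK : 0 ≤ K)
    (hy : ∀ x ∈ Icc x₁ x₂, HasDerivAt y (y' x) x ∧ HasDerivAt y' (q x * y x) x)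
    (hq : ∀ x ∈ Icc x₁ x₂, x ^ 2 * ‖q x‖ ≤ K ^ 2) {x₀ x : ℝ} (hx₀ : x₀ ∈ Icc x₁ x₂)
    (hx : x ∈ Icc x₁ x₂) :
    ‖y x‖ + x * ‖y' x‖ ≤
      2 * (⌈K⌉₊ + 1 : ℕ) * (x₂ / x₁) ^ (⌈K⌉₊ + 1 + 1) * (‖y x₀‖ + x₀ * ‖y' x₀‖) := by
  have hKn : K ≤ ((⌈K⌉₊ + 1 : ℕ) : ℝ) := by
    push_cast
    exact (Nat.le_ceil K).trans (le_add_of_nonneg_right zero_le_one)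
  refine norm_add_mul_norm_deriv_le_of_euler hx₁ (Nat.le_add_left 1 _) hy (fun t ht => ?_) hx₀ hx
  exact (hq t ht).trans (pow_le_pow_left₀ hK hKn 2)

end Literature.Analysis.ODE

end
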